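import Summits.QuantumFields.YangMills.Theorems.BalabanUVNodesN08LaunderingAbstract
import Summits.QuantumFields.YangMills.Theorems.BalabanUVNodesN08AxialLaunderingSpectator

/-!
# BalabanUVNodes ∕ N08 — THE LOCAL WEIL-LAUNDERING CORE WITH SPECTATORS: a weighted push-forward onto a FINITE FAMILY of group coordinates `ι → G` (a SUBSET of the coarse bonds),
# jointly with an arbitrary spectator, is `(spectator law) ⊗ Haar^ι` as soon as the source carries weight- and spectator-fixing symmetries realising the right translations of the
# coordinates in `T ⊆ ι` and the left translations of those outside `T` — the form the DELETION of a finished cluster consumes (launder only the coarse bonds near the cluster)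

Track A, DAG node N08 ([Balaban1985UV3] Thm 1 p. 257 ∕ Thm 2 p. 272; averaging [Balaban1987RG1] (0.4) p. 253).  Cell `pub-ymgap`, seat `pub-ymgap-dag-n08-d` g47 (R529-ym job;
DESIGN memo (M4)∕(M5): deletion of a finished cluster); ledger key `--supports stmt-QuantumFields-27364 --as helper` («cc 19936 (O‴χₛ) supply», director №326).  Generalises ✓p757419 `…N08LaunderingAbstract`
(target = ALL coarse bonds, no spectator) and ✓p754656 `…N08AxialLaunderingSpectator.eq_fst_prod_of_invariant` (right translations only).

CONTENTS ([folklore]; 0 `def`, 0 `sorry`): §1 on `ι → G` with `Measure.pi Haar`: `measurePreserving_mulLeft_pi` ∕ `measurePreserving_mulRight_pi`, `measurable_invOff_pi` ∕ `invOff_invOff_pi` ∕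
`map_invOff_pi` (partial coordinatewise inversion); §2 ★★ `eq_fst_prod_pi_of_mixed_translations` — a finite measure on `Y × (ι → G)` invariant under right translations of the coordinates in
`T` and left translations of those outside `T` is `(marginal) ⊗ Haar^ι`; §3 ★★★ `map_prod_eq_prod_pi_of_translations` — the source form with a density `f`, a coordinate map
`Φ : X → ι → G` and a spectator `φ : X → Y`.
HONEST: count-neutral helper; hTop ∕ (a)′∀ ∕ hJ NOT proved; N08 NOT discharged; R3 ≠ d = 4 ∕ mass gap ∕ Clay.
-/

noncomputable section

open MeasureTheory
open scoped ENNReal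

namespace Summit.QuantumFields.YangMills.Theorems.BalabanUVNodesN08LaunderingLocal

open Literature.MathematicalPhysics.QuantumFieldTheory.Balaban1983to89
open Summit.QuantumFields.YangMills.Theorems.BalabanUVNodesN08AxialLaunderingWeighted (map_withDensity_eq_of_comp_eq)
open Summit.QuantumFields.YangMills.Theorems.BalabanUVNodesN08AxialLaunderingSpectator (eq_fst_prod_of_invariant)

variable {ι : Type*} [Fintype ι] {G : Type*} [GaugeGroup G] [MeasurableSpace G] [HaarData G] [MeasurableMul₂ G] [MeasurableInv G]

/-! ## §1 Product Haar on `ι → G`: translations and partial inversion -/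

omit [MeasurableInv G] in
/-- Coordinatewise left multiplication preserves `Haar^ι`. [folklore] -/
theorem measurePreserving_mulLeft_pi (k : ι → G) :
    MeasurePreserving (fun (W : ι → G) (i : ι) => k i * W i) (Measure.pi fun _ : ι => (HaarData.haar : Measure G)) (Measure.pi fun _ : ι => (HaarData.haar : Measure G)) :=
  measurePreserving_pi (fun _ : ι => (HaarData.haar : Measure G)) (fun _ => HaarData.haar) (f := fun i x => k i * x)
    (fun i => ⟨measurable_const_mul (k i), HaarData.map_mul_left (k i)⟩)

omit [MeasurableInv G] in
/-- Coordinatewise right multiplication preserves `Haar^ι`. [folklore] -/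
theorem measurePreserving_mulRight_pi (k : ι → G) :
    MeasurePreserving (fun (W : ι → G) (i : ι) => W i * k i) (Measure.pi fun _ : ι => (HaarData.haar : Measure G)) (Measure.pi fun _ : ι => (HaarData.haar : Measure G)) :=
  measurePreserving_pi (fun _ : ι => (HaarData.haar : Measure G)) (fun _ => HaarData.haar) (f := fun i x => x * k i)
    (fun i => ⟨measurable_mul_const (k i), HaarData.map_mul_right (k i)⟩)

omit [Fintype ι] [HaarData G] [MeasurableMul₂ G] in
/-- Partial coordinatewise inversion (off `T`) is measurable. [folklore] -/
theorem measurable_invOff_pi (T : Set ι) [DecidablePred (· ∈ T)] :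
    Measurable (fun (W : ι → G) (i : ι) => if i ∈ T then W i else (W i)⁻¹) := by
  refine measurable_pi_iff.mpr fun i => ?_
  by_cases hi : i ∈ T
  · simp only [hi, if_true]; exact measurable_pi_apply i
  · simp only [hi, if_false]; exact (measurable_pi_apply i).inv

omit [Fintype ι] [MeasurableSpace G] [HaarData G] [MeasurableMul₂ G] [MeasurableInv G] in
/-- … is an involution. [folklore] -/
theorem invOff_invOff_pi (T : Set ι) [DecidablePred (· ∈ T)] (W : ι → G) :
    (fun i : ι => if i ∈ T then (fun i' => if i' ∈ T then W i' else (W i')⁻¹) i else ((fun i' => if i' ∈ T then W i' else (W i')⁻¹) i)⁻¹) = W := by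
  funext i; by_cases hi : i ∈ T <;> simp [hi]

omit [MeasurableMul₂ G] in
/-- … and preserves `Haar^ι`. [folklore] -/
theorem map_invOff_pi (T : Set ι) [DecidablePred (· ∈ T)] :
    (Measure.pi fun _ : ι => (HaarData.haar : Measure G)).map (fun (W : ι → G) (i : ι) => if i ∈ T then W i else (W i)⁻¹) =
      Measure.pi fun _ : ι => (HaarData.haar : Measure G) :=
  (measurePreserving_pi (fun _ : ι => (HaarData.haar : Measure G)) (fun _ => HaarData.haar) (f := fun i (x : G) => if i ∈ T then x else x⁻¹)
    (fun i => by
      by_cases hi : i ∈ T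
      · simp only [hi, if_true]; exact ⟨measurable_id, Measure.map_id⟩
      · simp only [hi, if_false]; exact ⟨measurable_inv, HaarData.map_inv⟩)).map_eq

/-! ## §2 Weil fibrewise, mixed translations -/

/-- ★★ **A FINITE MEASURE ON `Y × (ι → G)` INVARIANT UNDER RIGHT TRANSLATIONS OF THE COORDINATES IN `T` AND LEFT TRANSLATIONS OF THOSE OUTSIDE `T` IS `(marginal) ⊗ Haar^ι`**
(transport by the partial inversion off `T`, then ✓`eq_fst_prod_of_invariant`, then transport back). [folklore] -/
theorem eq_fst_prod_pi_of_mixed_translations {Y : Type*} [MeasurableSpace Y] (T : Set ι) [DecidablePred (· ∈ T)]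
    (κ : Measure (Y × (ι → G))) [IsFiniteMeasure κ]
    (hR : ∀ h : ι → G, (∀ i, i ∉ T → h i = 1) → κ.map (fun p => (p.1, fun i => p.2 i * h i)) = κ)
    (hL : ∀ h : ι → G, (∀ i, i ∈ T → h i = 1) → κ.map (fun p => (p.1, fun i => h i * p.2 i)) = κ) :
    κ = (κ.map Prod.fst).prod (Measure.pi fun _ : ι => (HaarData.haar : Measure G)) := by
  letI : Group (ι → G) := Pi.group
  letI : MeasurableMul₂ (ι → G) := Pi.measurableMul₂
  set ψ : (ι → G) → (ι → G) := fun W i => if i ∈ T then W i else (W i)⁻¹ with hψ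
  have hψm : Measurable ψ := measurable_invOff_pi (G := G) T
  have hψψ : ∀ W, ψ (ψ W) = W := fun W => invOff_invOff_pi (G := G) T W
  have hPm : Measurable (fun p : Y × (ι → G) => (p.1, ψ p.2)) := measurable_fst.prodMk (hψm.comp measurable_snd)
  set κ' := κ.map (fun p : Y × (ι → G) => (p.1, ψ p.2)) with hκ'
  haveI : IsFiniteMeasure κ' := Measure.isFiniteMeasure_map _ _
  -- `κ'` is right-invariant in the group coordinate under ALL translations
  have hinv : ∀ g : ι → G, κ'.map (fun p : Y × (ι → G) => (p.1, p.2 * g)) = κ' := by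
    intro g
    set gT : ι → G := fun i => if i ∈ T then g i else 1 with hgT
    set gC : ι → G := fun i => if i ∈ T then 1 else (g i)⁻¹ with hgC
    have hgT1 : ∀ i, i ∉ T → gT i = 1 := fun i hi => by simp [hgT, hi]
    have hgC1 : ∀ i, i ∈ T → gC i = 1 := fun i hi => by simp [hgC, hi]
    have hTm : Measurable (fun p : Y × (ι → G) => (p.1, p.2 * g)) := measurable_fst.prodMk (measurable_snd.mul_const g)
    have hRm : Measurable (fun p : Y × (ι → G) => (p.1, fun i => p.2 i * gT i)) :=
      measurable_fst.prodMk (measurable_pi_iff.mpr fun i => ((measurable_pi_apply i).comp measurable_snd).mul_const _)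
    have hLm : Measurable (fun p : Y × (ι → G) => (p.1, fun i => gC i * p.2 i)) :=
      measurable_fst.prodMk (measurable_pi_iff.mpr fun i => ((measurable_pi_apply i).comp measurable_snd).const_mul _)
    have hcomp : ((fun p : Y × (ι → G) => (p.1, p.2 * g)) ∘ (fun p : Y × (ι → G) => (p.1, ψ p.2))) =
        (fun p : Y × (ι → G) => (p.1, ψ p.2)) ∘ ((fun p : Y × (ι → G) => (p.1, fun i => gC i * p.2 i)) ∘ (fun p => (p.1, fun i => p.2 i * gT i))) := by
      funext p
      refine Prod.ext rfl ?_
      funext i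
      show ψ p.2 i * g i = ψ (fun i' => gC i' * (p.2 i' * gT i')) i
      by_cases hi : i ∈ T
      · simp [hψ, hgT, hgC, hi]
      · simp [hψ, hgT, hgC, hi]
    calc κ'.map (fun p => (p.1, p.2 * g)) = κ.map ((fun p : Y × (ι → G) => (p.1, p.2 * g)) ∘ (fun p => (p.1, ψ p.2))) := by rw [hκ', Measure.map_map hTm hPm]
      _ = κ.map ((fun p : Y × (ι → G) => (p.1, ψ p.2)) ∘ ((fun p : Y × (ι → G) => (p.1, fun i => gC i * p.2 i)) ∘ (fun p => (p.1, fun i => p.2 i * gT i)))) := by rw [hcomp]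
      _ = ((κ.map (fun p : Y × (ι → G) => (p.1, fun i => p.2 i * gT i))).map (fun p => (p.1, fun i => gC i * p.2 i))).map (fun p => (p.1, ψ p.2)) := by
          rw [Measure.map_map hPm hLm, Measure.map_map (hPm.comp hLm) hRm]
          rfl
      _ = κ' := by rw [hR gT hgT1, hL gC hgC1]
  have hW := eq_fst_prod_of_invariant (Measure.pi fun _ : ι => (HaarData.haar : Measure G)) κ'
    (fun g => (measurePreserving_mulLeft_pi (G := G) (ι := ι) g).map_eq) hinv
  have hfst : κ'.map Prod.fst = κ.map Prod.fst := by
    rw [hκ', Measure.map_map measurable_fst hPm]; rfl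
  -- transport back
  have hback : κ = κ'.map (fun p : Y × (ι → G) => (p.1, ψ p.2)) := by
    rw [hκ', Measure.map_map hPm hPm]
    have : ((fun p : Y × (ι → G) => (p.1, ψ p.2)) ∘ fun p => (p.1, ψ p.2)) = id := by
      funext p; exact Prod.ext rfl (hψψ p.2)
    rw [this, Measure.map_id]
  haveI : IsFiniteMeasure (κ.map (Prod.fst : Y × (ι → G) → Y)) := Measure.isFiniteMeasure_map _ _
  -- `(μ ⊗ π).map (id × ψ) = μ ⊗ (π.map ψ) = μ ⊗ π`
  have hprod : ((κ.map Prod.fst).prod (Measure.pi fun _ : ι => (HaarData.haar : Measure G))).map (fun p : Y × (ι → G) => (p.1, ψ p.2)) =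
      (κ.map Prod.fst).prod ((Measure.pi fun _ : ι => (HaarData.haar : Measure G)).map ψ) := by
    have : (fun p : Y × (ι → G) => (p.1, ψ p.2)) = Prod.map id ψ := by funext p; rfl
    rw [this, ← Measure.map_prod_map _ _ measurable_id hψm, Measure.map_id]
  have hπψ : (Measure.pi fun _ : ι => (HaarData.haar : Measure G)).map ψ = Measure.pi fun _ : ι => (HaarData.haar : Measure G) := by
    rw [hψ]; exact map_invOff_pi (G := G) T
  calc κ = κ'.map (fun p : Y × (ι → G) => (p.1, ψ p.2)) := hback
    _ = ((κ'.map Prod.fst).prod (Measure.pi fun _ : ι => (HaarData.haar : Measure G))).map (fun p : Y × (ι → G) => (p.1, ψ p.2)) := by rw [← hW]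
    _ = ((κ.map Prod.fst).prod (Measure.pi fun _ : ι => (HaarData.haar : Measure G))).map (fun p : Y × (ι → G) => (p.1, ψ p.2)) := by rw [hfst]
    _ = (κ.map Prod.fst).prod (Measure.pi fun _ : ι => (HaarData.haar : Measure G)) := by rw [hprod, hπψ]

/-! ## §3 The source form with a density and a spectator -/

/-- ★★★ **THE LOCAL WEIL-LAUNDERING CORE WITH SPECTATORS.**  `(X, μ)` a source, `f ≥ 0` measurable of finite integral, `Φ : X → ι → G` (a finite family of group coordinates — e.g. the
coarse bonds NEAR a cluster) and `φ : X → Y` (the spectator — e.g. all other coarse bonds and the other clusters' data) measurable, `T ⊆ ι`.  If every right translation of the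
`T`-coordinates and every left translation of the other coordinates of `Φ` is realised by a `μ`-preserving map fixing `f` AND `φ`, then
`(μ.withDensity f).map (fun x ↦ (φ x, Φ x)) = ((μ.withDensity f).map φ) ⊗ Haar^ι` — the laundered coordinates are exactly Haar and INDEPENDENT of the spectator.
[cite: Balaban1985Averaging, (10) p.19 (bookkeeping); Balaban1987RG1, (0.4) p.253] -/
theorem map_prod_eq_prod_pi_of_translations {X Y : Type*} [MeasurableSpace X] [MeasurableSpace Y] (μ : Measure X) (T : Set ι) [DecidablePred (· ∈ T)]
    {f : X → ℝ≥0∞} (hf : Measurable f) (hfin : ∫⁻ x, f x ∂μ ≠ ∞) {Φ : X → ι → G} (hΦ : Measurable Φ) {φ : X → Y} (hφ : Measurable φ)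
    (hR : ∀ h : ι → G, (∀ i, i ∉ T → h i = 1) →
      ∃ R : X → X, MeasurePreserving R μ μ ∧ (∀ x, f (R x) = f x) ∧ (∀ x, φ (R x) = φ x) ∧ (∀ x, Φ (R x) = fun i => Φ x i * h i))
    (hL : ∀ h : ι → G, (∀ i, i ∈ T → h i = 1) →
      ∃ L : X → X, MeasurePreserving L μ μ ∧ (∀ x, f (L x) = f x) ∧ (∀ x, φ (L x) = φ x) ∧ (∀ x, Φ (L x) = fun i => h i * Φ x i)) :
    (μ.withDensity f).map (fun x => (φ x, Φ x)) = ((μ.withDensity f).map φ).prod (Measure.pi fun _ : ι => (HaarData.haar : Measure G)) := by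
  haveI : IsFiniteMeasure (μ.withDensity f) := isFiniteMeasure_withDensity hfin
  have hpair : Measurable (fun x => (φ x, Φ x)) := hφ.prodMk hΦ
  set κ := (μ.withDensity f).map (fun x => (φ x, Φ x)) with hκ
  haveI : IsFiniteMeasure κ := Measure.isFiniteMeasure_map _ _
  have hfst : κ.map Prod.fst = (μ.withDensity f).map φ := by rw [hκ, Measure.map_map measurable_fst hpair]; rfl
  rw [← hfst]
  refine eq_fst_prod_pi_of_mixed_translations (G := G) T κ ?_ ?_
  · intro h hh
    obtain ⟨R, hRmp, hRf, hRφ, hRΦ⟩ := hR h hh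
    have hTm : Measurable (fun p : Y × (ι → G) => (p.1, fun i => p.2 i * h i)) :=
      measurable_fst.prodMk (measurable_pi_iff.mpr fun i => ((measurable_pi_apply i).comp measurable_snd).mul_const _)
    have hcomp : ((fun p : Y × (ι → G) => (p.1, fun i => p.2 i * h i)) ∘ fun x => (φ x, Φ x)) = (fun x => (φ x, Φ x)) ∘ R := by
      funext x; exact Prod.ext (hRφ x).symm (by show (fun i => Φ x i * h i) = Φ (R x); rw [hRΦ x])
    calc κ.map (fun p => (p.1, fun i => p.2 i * h i)) = (μ.withDensity f).map ((fun p : Y × (ι → G) => (p.1, fun i => p.2 i * h i)) ∘ fun x => (φ x, Φ x)) := by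
          rw [hκ, Measure.map_map hTm hpair]
      _ = (μ.withDensity f).map ((fun x => (φ x, Φ x)) ∘ R) := by rw [hcomp]
      _ = ((μ.withDensity f).map R).map (fun x => (φ x, Φ x)) := (Measure.map_map hpair hRmp.measurable).symm
      _ = κ := by rw [map_withDensity_eq_of_comp_eq hRmp hf hRf]
  · intro h hh
    obtain ⟨Lm, hLmp, hLf, hLφ, hLΦ⟩ := hL h hh
    have hTm : Measurable (fun p : Y × (ι → G) => (p.1, fun i => h i * p.2 i)) :=
      measurable_fst.prodMk (measurable_pi_iff.mpr fun i => ((measurable_pi_apply i).comp measurable_snd).const_mul _)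
    have hcomp : ((fun p : Y × (ι → G) => (p.1, fun i => h i * p.2 i)) ∘ fun x => (φ x, Φ x)) = (fun x => (φ x, Φ x)) ∘ Lm := by
      funext x; exact Prod.ext (hLφ x).symm (by show (fun i => h i * Φ x i) = Φ (Lm x); rw [hLΦ x])
    calc κ.map (fun p => (p.1, fun i => h i * p.2 i)) = (μ.withDensity f).map ((fun p : Y × (ι → G) => (p.1, fun i => h i * p.2 i)) ∘ fun x => (φ x, Φ x)) := by
          rw [hκ, Measure.map_map hTm hpair]
      _ = (μ.withDensity f).map ((fun x => (φ x, Φ x)) ∘ Lm) := by rw [hcomp]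
      _ = ((μ.withDensity f).map Lm).map (fun x => (φ x, Φ x)) := (Measure.map_map hpair hLmp.measurable).symm
      _ = κ := by rw [map_withDensity_eq_of_comp_eq hLmp hf hLf]

end Summit.QuantumFields.YangMills.Theorems.BalabanUVNodesN08LaunderingLocal

end
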